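import Summits.CriticalPhenomena.Ising3D.TaylorTableOddCoeffTM
import HarnessLib

/-!
# The TABLE layer XXIVa: τ-triple Taylor-model rows of the regularised coefficient array (defs, digests, triple semantics)
(cell `pub-ising3x`, seat boot-1 gen 15/16; the MERGED-2 (first-order) odd-head test chain, landed per LEAN-PLAN-MERGED2 in ten modules)

HONEST FRAMING: lottery ticket; floor = tightest certified 3D Ising CFT bounds; no exact-solution
claim without a proof. Island framing: certified exclusion region at stated derivative order and
assumptions; not a determination of the 3D Ising critical exponents beyond that.

Drafted and kernel-checked as one combined file (oddtest2/lean-draft/Merged2CellCombined.lean, 83 theorems, standard axioms); landed in slices of ≤ 400 lines. [folklore]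
-/

namespace Summit.CriticalPhenomena.Ising3D

open Finset Set
open Literature.Analysis.ValidatedNumerics Literature.Analysis.ValidatedNumerics.PolyMP
open Literature.Analysis.ValidatedNumerics.NumericsMP
open Literature.MathematicalPhysics.QuantumFieldTheory.ConformalBootstrap3D
open Literature.MathematicalPhysics.QuantumFieldTheory.ConformalBootstrap3D.HRTM
open Literature.MathematicalPhysics.QuantumFieldTheory.ConformalBootstrap3D.PointKernel (mulQ mem_mulQ legendreLamQ)

namespace HRTMAB2

/-- A `τ`-triple of scaled intervals: the coefficients of `τ⁰, τ¹, τ²` (the `τ²` slot absorbs every higher-order term, `|τ| ≤ W`). [folklore] -/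
structure T3 where
  /-- `τ⁰` coefficient interval -/
  c0 : MI
  /-- `τ¹` coefficient interval -/
  c1 : MI
  /-- `τ²` coefficient interval (incl. folded higher orders) -/
  c2 : MI
  deriving DecidableEq, Repr, Inhabited

namespace T3

/-- The zero triple. [folklore] -/
def zero : T3 := ⟨zI, zI, zI⟩

/-- Point triple of three rationals at scale `S`. [folklore] -/
def ofRat3 (S : ℕ) (q0 q1 q2 : ℚ) : T3 := ⟨ofRat S q0, ofRat S q1, ofRat S q2⟩

/-- Sum. [folklore] -/
def add (x y : T3) : T3 := ⟨MI.add x.c0 y.c0, MI.add x.c1 y.c1, MI.add x.c2 y.c2⟩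

/-- Difference. [folklore] -/
def sub (x y : T3) : T3 := ⟨MI.sub x.c0 y.c0, MI.sub x.c1 y.c1, MI.sub x.c2 y.c2⟩

/-- Product with an exact rational. [folklore] -/
def smul (x : T3) (q : ℚ) : T3 := ⟨mulQ x.c0 q, mulQ x.c1 q, mulQ x.c2 q⟩

/-- Upper bound of `|x|·S·W` over the interval, `W = Wn / Wd`, rounded up. [folklore] -/
def absW (x : MI) (Wn : ℤ) (Wd : ℕ) : ℤ := Numerics.cdiv (x.absHi * Wn) Wd

/-- Product of two triples at scale `S`, truncated at `τ²`: `e₃ = x₁y₂ + x₂y₁` and `e₄ = x₂y₂` are folded into the `τ²` slot as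
`± (|e₃| W + |e₄| W²)` (valid for `|τ| ≤ W`). [folklore] -/
def mul (S : ℕ) (Wn : ℤ) (Wd : ℕ) (x y : T3) : T3 :=
  let e0 := MI.mul S x.c0 y.c0
  let e1 := MI.add (MI.mul S x.c0 y.c1) (MI.mul S x.c1 y.c0)
  let e2 := MI.add (MI.add (MI.mul S x.c0 y.c2) (MI.mul S x.c1 y.c1)) (MI.mul S x.c2 y.c0)
  let e3 := MI.add (MI.mul S x.c1 y.c2) (MI.mul S x.c2 y.c1)
  let e4 := MI.mul S x.c2 y.c2
  let r : ℤ := absW e3 Wn Wd + absW ⟨0, absW e4 Wn Wd⟩ Wn Wd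
  ⟨e0, e1, MI.widen e2 r⟩

/-- Well-formedness (`lo ≤ hi` in all three slots) — a digest that forces full kernel evaluation. [folklore] -/
def wf (x : T3) : Bool := decide (x.c0.lo ≤ x.c0.hi) && decide (x.c1.lo ≤ x.c1.hi) && decide (x.c2.lo ≤ x.c2.hi)

end T3

/-- A `ρ`-Taylor model whose coefficients are `τ`-triples. [folklore] -/
abbrev TPoly := List T3

/-- Coefficient access (zero beyond the end). [folklore] -/
def cf2 (P : TPoly) (k : ℕ) : T3 := P.getD k T3.zero

/-- The three `τ`-exact numerator coefficients of `c·(u + ρ)(v + ρ)` with `u = α + 2a(τ)`, `v = α + 2b(τ)`, `a = a₀ + a₁τ`, `b = b₀ + b₁τ`: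
`G₀ = c·u·v` (degree 2 in `τ`), `G₁ = c·(u + v)` (degree 1), `G₂ = c`. [folklore] -/
def quadI2 (S : ℕ) (c α a0 a1 b0 b1 : ℚ) : T3 × T3 × T3 :=
  let u0 := α + 2 * a0
  let u1 := 2 * a1
  let v0 := α + 2 * b0
  let v1 := 2 * b1
  (T3.ofRat3 S (c * u0 * v0) (c * (u0 * v1 + u1 * v0)) (c * u1 * v1),
   T3.ofRat3 S (c * (u0 + v0)) (c * (u1 + v1)) 0,
   T3.ofRat3 S c 0 0)

/-- Coefficient `k` of `(G₀ + G₁ρ + G₂ρ²)·P(ρ)` for triples. [folklore] -/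
def conv3I2 (S : ℕ) (Wn : ℤ) (Wd : ℕ) (G0 G1 G2 : T3) (P : TPoly) (k : ℕ) : T3 :=
  let t0 := T3.mul S Wn Wd (cf2 P k) G0
  let t1 := if 1 ≤ k then T3.add t0 (T3.mul S Wn Wd (cf2 P (k - 1)) G1) else t0
  if 2 ≤ k then T3.add t1 (T3.mul S Wn Wd (cf2 P (k - 2)) G2) else t1

/-- Re-assemble three component `IPoly`s (`τ⁰, τ¹, τ²`) of length `D+1` into one `TPoly`. [folklore] -/
def zip3 (D : ℕ) (P0 P1 P2 : IPoly) : TPoly := vtab (D + 1) fun k => ⟨cf P0 k, cf P1 k, cf P2 k⟩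

/-- The scaled `ρ`-remainder of the synthetic division by `p₀ + p₁ρ` (the `rem` of `HRTMI.entryTMI`, as a function of the numerator intervals). [folklore] -/
def remOf (e D : ℕ) (p0 p1 : ℚ) (num : ℕ → MI) : ℤ :=
  let bD := (bList num p0 p1 D).headD zI
  let r1 : ℤ := absHiI (MI.sub (num (D + 1)) (mulQ bD p1))
  let r2 : ℤ := absHiI (num (D + 2))
  let rn : ℤ := r1 / (2 ^ (e * (D + 1)) : ℤ) + r2 / (2 ^ (e * (D + 2)) : ℤ) + 2
  let m : ℚ := |p0| - |p1| / (2 ^ e : ℚ)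
  ⌈(rn : ℚ) / m⌉

/-- One component's synthetic division + `ρ`-remainder, exactly as `HRTMI.entryTMI` (numerators tabulated in `nums`). [folklore] -/
def divComp (e D : ℕ) (p0 p1 : ℚ) (nums : List T3) (π : T3 → MI) : IPoly :=
  let num : ℕ → MI := fun k => π (nums.getD k T3.zero)
  widen0 (bList num p0 p1 D).reverse (remOf e D p0 p1 num)

/-- The triple Taylor model of one recursion entry from the models of its two parents (`Pp`, `Pm`) and the `τ`-exact numerator triples. [folklore] -/
def entryTMI2 (S e D : ℕ) (Wn : ℤ) (Wd : ℕ) (Gp Gm : T3 × T3 × T3) (p0 p1 : ℚ) (Pp Pm : TPoly) : TPoly :=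
  let num : ℕ → T3 := fun k =>
    T3.add (conv3I2 S Wn Wd Gp.1 Gp.2.1 Gp.2.2 Pp k) (conv3I2 S Wn Wd Gm.1 Gm.2.1 Gm.2.2 Pm k)
  let nums : List T3 := vtab (D + 3) num
  zip3 D (divComp e D p0 p1 nums T3.c0) (divComp e D p0 p1 nums T3.c1) (divComp e D p0 p1 nums T3.c2)

/-- The pole entry `R_{1,ℓ−1}` as an exact triple quadratic. [folklore] -/
def poleTM2 (S : ℕ) (A : ℚ) (ℓ : ℕ) (a0 a1 b0 b1 : ℚ) : TPoly :=
  let G := quadI2 S ((ℓ : ℚ) / (2 * (2 * ℓ + 1))) (A - ℓ - 1) a0 a1 b0 b1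
  [G.1, G.2.1, G.2.2]

/-- One entry of level `n+1` from the row of level `n` (as `HRTMAB.stepEntry`). [folklore] -/
def stepEntry2 (S : ℕ) (A : ℚ) (ℓ e D : ℕ) (Wn : ℤ) (Wd : ℕ) (a0 a1 b0 b1 : ℚ) (n j : ℕ) (row : List TPoly) : TPoly :=
  if InDescendantRange ℓ (n + 1) j then
    if n = 0 ∧ j + 1 = ℓ then poleTM2 S A ℓ a0 a1 b0 b1
    else
      let Gp := quadI2 S (if j = 0 then 0 else (j : ℚ) / (2 * j - 1)) (A + n + j - 1) a0 a1 b0 b1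
      let Gm := quadI2 S (((j : ℚ) + 1) / (2 * j + 3)) (A + n - j - 2) a0 a1 b0 b1
      entryTMI2 S e D Wn Wd Gp Gm (p0Q A ℓ n j) (p1Q n)
        (if j = 0 then [] else row.getD (j - 1) []) (row.getD (j + 1) [])
  else []

/-- The row of level `n+1`. [folklore] -/
def stepRow2 (S : ℕ) (A : ℚ) (ℓ e D : ℕ) (Wn : ℤ) (Wd : ℕ) (a0 a1 b0 b1 : ℚ) (n : ℕ) (row : List TPoly) : List TPoly :=
  vtab (ℓ + n + 2) fun j => stepEntry2 S A ℓ e D Wn Wd a0 a1 b0 b1 n j row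

/-- Rows of levels `nF, …, 0` (newest first); level `0` is the exact, `τ`-independent linear model `(A − b_ℓ) + ρ` at `j = ℓ`. [folklore] -/
def rows2 (S : ℕ) (A : ℚ) (ℓ e D : ℕ) (Wn : ℤ) (Wd : ℕ) (a0 a1 b0 b1 : ℚ) : ℕ → List (List TPoly)
  | 0 => [vtab (ℓ + 1) fun j => if j = ℓ then [T3.ofRat3 S (A - bQ ℓ) 0 0, T3.ofRat3 S 1 0 0] else []]
  | n + 1 =>
      let rs := rows2 S A ℓ e D Wn Wd a0 a1 b0 b1 n
      stepRow2 S A ℓ e D Wn Wd a0 a1 b0 b1 n (rs.headD []) :: rs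

/-- Digest forcing the evaluation of every interval of a triple table. [folklore] -/
def wfRows2 (rs : List (List TPoly)) : Bool := rs.all fun row => row.all fun P => P.all T3.wf

/-- Digest forcing the evaluation of every interval of an order-0 table (`HRTMAB.rows`). [folklore] -/
def wfRows0 (rs : List (List IPoly)) : Bool := rs.all fun row => row.all fun P => P.all fun I => decide (I.lo ≤ I.hi)

/-! ### Structural lemmas used by the split table files (`(rows2 … top).take m = …` chunks) -/

/-- Unfolding one level. [folklore] -/
theorem rows2_succ (S : ℕ) (A : ℚ) (ℓ e D : ℕ) (Wn : ℤ) (Wd : ℕ) (a0 a1 b0 b1 : ℚ) (n : ℕ) :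
    rows2 S A ℓ e D Wn Wd a0 a1 b0 b1 (n + 1) =
      stepRow2 S A ℓ e D Wn Wd a0 a1 b0 b1 n ((rows2 S A ℓ e D Wn Wd a0 a1 b0 b1 n).headD []) ::
        rows2 S A ℓ e D Wn Wd a0 a1 b0 b1 n := rfl

/-- The table has `nF + 1` levels. [folklore] -/
theorem length_rows2 (S : ℕ) (A : ℚ) (ℓ e D : ℕ) (Wn : ℤ) (Wd : ℕ) (a0 a1 b0 b1 : ℚ) :
    ∀ n : ℕ, (rows2 S A ℓ e D Wn Wd a0 a1 b0 b1 n).length = n + 1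
  | 0 => by simp [rows2, vtab]
  | n + 1 => by rw [rows2_succ, List.length_cons, length_rows2]

/-- **Dropping the newest `m` levels gives the shallower table** — the glue between position-chunk table files. [folklore] -/
theorem drop_rows2 (S : ℕ) (A : ℚ) (ℓ e D : ℕ) (Wn : ℤ) (Wd : ℕ) (a0 a1 b0 b1 : ℚ) (n : ℕ) :
    ∀ m : ℕ, (rows2 S A ℓ e D Wn Wd a0 a1 b0 b1 (n + m)).drop m = rows2 S A ℓ e D Wn Wd a0 a1 b0 b1 n
  | 0 => by simp
  | m + 1 => by
      rw [← Nat.add_assoc, rows2_succ, List.drop_succ_cons, drop_rows2]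

/-- A full table is the concatenation of a `take` chunk and the shallower table. [folklore] -/
theorem rows2_eq_take_append (S : ℕ) (A : ℚ) (ℓ e D : ℕ) (Wn : ℤ) (Wd : ℕ) (a0 a1 b0 b1 : ℚ) (n m : ℕ) :
    rows2 S A ℓ e D Wn Wd a0 a1 b0 b1 (n + m) =
      (rows2 S A ℓ e D Wn Wd a0 a1 b0 b1 (n + m)).take m ++ rows2 S A ℓ e D Wn Wd a0 a1 b0 b1 n := by
  conv_lhs => rw [← List.take_append_drop m (rows2 S A ℓ e D Wn Wd a0 a1 b0 b1 (n + m))]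
  rw [drop_rows2]

/-! ### Semantics of a triple and soundness of the truncated product (the one new inequality of the table layer) -/

/-- `f` lies in the triple `x` on `|τ| ≤ W`: FIXED reals `c₀ ∈ x.c0`, `c₁ ∈ x.c1` and, for every admissible `τ`, SOME `c₂ ∈ x.c2` (it may depend on
`τ`: the slot absorbs the folded tails) with `f τ = c₀ + c₁ τ + c₂ τ²` (a semantics predicate of this development, not a cited fact). [folklore] -/
def T3.Mem (S : ℕ) (W : ℝ) (f : ℝ → ℝ) (x : T3) : Prop :=
  ∃ c0 c1 : ℝ, MI.mem S c0 x.c0 ∧ MI.mem S c1 x.c1 ∧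
    ∀ τ : ℝ, |τ| ≤ W → ∃ c2 : ℝ, MI.mem S c2 x.c2 ∧ f τ = c0 + c1 * τ + c2 * τ ^ 2


/-- Membership only depends on the function's values. [folklore] -/
theorem T3.Mem_congr {S : ℕ} {W : ℝ} {f g : ℝ → ℝ} {x : T3} (h : ∀ τ, f τ = g τ) : T3.Mem S W f x ↔ T3.Mem S W g x := by
  have e : f = g := funext h
  rw [e]

/-- `|τ·u|·S ≤ absW U` for `u ∈ U`, `|τ| ≤ Wn/Wd`. [folklore] -/
theorem T3.absW_bound {S : ℕ} {Wn : ℤ} {Wd : ℕ} (hWd : 0 < Wd) {u : ℝ} {U : MI} (hu : MI.mem S u U)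
    {τ : ℝ} (hτ : |τ| ≤ (Wn : ℝ) / Wd) : |τ * u| * S ≤ (T3.absW U Wn Wd : ℝ) := by
  have hA := MI.abs_le_absHi hu
  have hWd' : (0 : ℝ) < (Wd : ℝ) := by exact_mod_cast hWd
  have h1 : |τ * u| * S = |τ| * (|u| * S) := by rw [abs_mul]; ring
  have h2 : |τ| * (|u| * S) ≤ (Wn : ℝ) / Wd * (U.absHi : ℝ) :=
    mul_le_mul hτ hA (by positivity) (le_trans (abs_nonneg τ) hτ)
  have h3 : (Wn : ℝ) / Wd * (U.absHi : ℝ) = ((U.absHi * Wn : ℤ) : ℝ) / (Wd : ℤ) := by push_cast; ring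
  have h4 := Literature.Analysis.ValidatedNumerics.Numerics.div_le_cdiv (a := U.absHi * Wn) (b := (Wd : ℤ)) (by exact_mod_cast hWd)
  simp only [T3.absW]
  calc |τ * u| * S = |τ| * (|u| * S) := h1
    _ ≤ (Wn : ℝ) / Wd * (U.absHi : ℝ) := h2
    _ = ((U.absHi * Wn : ℤ) : ℝ) / (Wd : ℤ) := h3
    _ ≤ _ := h4

/-- Variant with a real bound `|v|·S ≤ A` instead of a membership: `|τ·v|·S ≤ absW ⟨0, A⟩`. [folklore] -/
theorem T3.absW_bound' {S : ℕ} {Wn : ℤ} {Wd : ℕ} (hWd : 0 < Wd) {v : ℝ} {A : ℤ} (hv : |v| * S ≤ (A : ℝ))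
    {τ : ℝ} (hτ : |τ| ≤ (Wn : ℝ) / Wd) : |τ * v| * S ≤ (T3.absW ⟨0, A⟩ Wn Wd : ℝ) := by
  have hA0 : (0 : ℝ) ≤ (A : ℝ) := le_trans (by positivity) hv
  have hA0' : (0 : ℤ) ≤ A := by exact_mod_cast hA0
  have hWd' : (0 : ℝ) < (Wd : ℝ) := by exact_mod_cast hWd
  have habs : (MI.absHi ⟨0, A⟩ : ℤ) = A := by
    unfold MI.absHi; rw [abs_zero, abs_of_nonneg hA0']; exact max_eq_right hA0'
  have h1 : |τ * v| * S = |τ| * (|v| * S) := by rw [abs_mul]; ring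
  have h2 : |τ| * (|v| * S) ≤ (Wn : ℝ) / Wd * (A : ℝ) :=
    mul_le_mul hτ hv (by positivity) (le_trans (abs_nonneg τ) hτ)
  have h3 : (Wn : ℝ) / Wd * (A : ℝ) = ((A * Wn : ℤ) : ℝ) / (Wd : ℤ) := by push_cast; ring
  have h4 := Literature.Analysis.ValidatedNumerics.Numerics.div_le_cdiv (a := A * Wn) (b := (Wd : ℤ)) (by exact_mod_cast hWd)
  simp only [T3.absW, habs]
  calc |τ * v| * S = |τ| * (|v| * S) := h1
    _ ≤ (Wn : ℝ) / Wd * (A : ℝ) := h2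
    _ = ((A * Wn : ℤ) : ℝ) / (Wd : ℤ) := h3
    _ ≤ _ := h4

/-- **Soundness of the truncated triple product**: `f ∈ x`, `g ∈ y` on `|τ| ≤ Wn/Wd` ⇒ `f·g ∈ T3.mul x y`. The `τ³, τ⁴` terms
`τ·e₃ + τ²·e₄` are absorbed into the `τ²` slot by `MI.widen` with `|τ e₃ + τ² e₄|·S ≤ absW E₃ + absW ⟨0, absW E₄⟩`. [folklore] -/
theorem T3.mem_mul {S : ℕ} (hS : 0 < S) {Wn : ℤ} {Wd : ℕ} (hWd : 0 < Wd) {f g : ℝ → ℝ} {x y : T3}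
    (hf : T3.Mem S ((Wn : ℝ) / Wd) f x) (hg : T3.Mem S ((Wn : ℝ) / Wd) g y) :
    T3.Mem S ((Wn : ℝ) / Wd) (fun τ => f τ * g τ) (T3.mul S Wn Wd x y) := by
  obtain ⟨c0, c1, hc0, hc1, hcf⟩ := hf
  obtain ⟨d0, d1, hd0, hd1, hdg⟩ := hg
  refine ⟨c0 * d0, c0 * d1 + c1 * d0, MI.mem_mul hS hc0 hd0, MI.mem_add (MI.mem_mul hS hc0 hd1) (MI.mem_mul hS hc1 hd0), ?_⟩
  intro τ hτ
  obtain ⟨c2, hc2, ef⟩ := hcf τ hτ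
  obtain ⟨d2, hd2, eg⟩ := hdg τ hτ
  -- the exact τ², τ³, τ⁴ coefficients and their enclosures
  have he2 : MI.mem S (c0 * d2 + c1 * d1 + c2 * d0)
      (MI.add (MI.add (MI.mul S x.c0 y.c2) (MI.mul S x.c1 y.c1)) (MI.mul S x.c2 y.c0)) :=
    MI.mem_add (MI.mem_add (MI.mem_mul hS hc0 hd2) (MI.mem_mul hS hc1 hd1)) (MI.mem_mul hS hc2 hd0)
  have he3 : MI.mem S (c1 * d2 + c2 * d1) (MI.add (MI.mul S x.c1 y.c2) (MI.mul S x.c2 y.c1)) :=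
    MI.mem_add (MI.mem_mul hS hc1 hd2) (MI.mem_mul hS hc2 hd1)
  have he4 : MI.mem S (c2 * d2) (MI.mul S x.c2 y.c2) := MI.mem_mul hS hc2 hd2
  -- the folded τ² coefficient
  refine ⟨(c0 * d2 + c1 * d1 + c2 * d0) + τ * (c1 * d2 + c2 * d1) + τ ^ 2 * (c2 * d2), ?_, ?_⟩
  · simp only [T3.mul]
    apply MI.mem_widen he2
    have b3 := T3.absW_bound (S := S) (Wn := Wn) hWd he3 hτ
    have b4 := T3.absW_bound (S := S) (Wn := Wn) hWd he4 hτ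
    have b4' := T3.absW_bound' (S := S) hWd b4 hτ
    have e : (c0 * d2 + c1 * d1 + c2 * d0) + τ * (c1 * d2 + c2 * d1) + τ ^ 2 * (c2 * d2) - (c0 * d2 + c1 * d1 + c2 * d0)
        = τ * (c1 * d2 + c2 * d1) + τ * (τ * (c2 * d2)) := by ring
    rw [e]
    have hS0 : (0 : ℝ) ≤ (S : ℝ) := by positivity
    calc |τ * (c1 * d2 + c2 * d1) + τ * (τ * (c2 * d2))| * S
        ≤ (|τ * (c1 * d2 + c2 * d1)| + |τ * (τ * (c2 * d2))|) * S := by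
          exact mul_le_mul_of_nonneg_right (abs_add_le _ _) hS0
      _ = |τ * (c1 * d2 + c2 * d1)| * S + |τ * (τ * (c2 * d2))| * S := by ring
      _ ≤ _ := by push_cast; exact add_le_add b3 b4'
  · change f τ * g τ = _
    rw [ef, eg]; ring

/-- The zero triple contains the zero function. [folklore] -/
theorem T3.mem_zero (S : ℕ) (W : ℝ) : T3.Mem S W (fun _ => 0) T3.zero :=
  ⟨0, 0, HRTM.mem_zI S, HRTM.mem_zI S, fun τ _ => ⟨0, HRTM.mem_zI S, by ring⟩⟩

/-- An exact `τ`-quadratic with rational coefficients lies in its point triple. [folklore] -/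
theorem T3.mem_ofRat3 (S : ℕ) (W : ℝ) (q0 q1 q2 : ℚ) :
    T3.Mem S W (fun τ => (q0 : ℝ) + (q1 : ℝ) * τ + (q2 : ℝ) * τ ^ 2) (T3.ofRat3 S q0 q1 q2) :=
  ⟨q0, q1, mem_ofRat S q0, mem_ofRat S q1, fun _ _ => ⟨q2, mem_ofRat S q2, rfl⟩⟩

/-- Sum. [folklore] -/
theorem T3.mem_add {S : ℕ} {W : ℝ} {f g : ℝ → ℝ} {x y : T3} (hf : T3.Mem S W f x) (hg : T3.Mem S W g y) :
    T3.Mem S W (fun τ => f τ + g τ) (T3.add x y) := by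
  obtain ⟨c0, c1, hc0, hc1, hcf⟩ := hf
  obtain ⟨d0, d1, hd0, hd1, hdg⟩ := hg
  refine ⟨c0 + d0, c1 + d1, MI.mem_add hc0 hd0, MI.mem_add hc1 hd1, fun τ hτ => ?_⟩
  obtain ⟨c2, hc2, ef⟩ := hcf τ hτ
  obtain ⟨d2, hd2, eg⟩ := hdg τ hτ
  exact ⟨c2 + d2, MI.mem_add hc2 hd2, by simp only [ef, eg]; ring⟩

/-- Difference. [folklore] -/
theorem T3.mem_sub {S : ℕ} {W : ℝ} {f g : ℝ → ℝ} {x y : T3} (hf : T3.Mem S W f x) (hg : T3.Mem S W g y) :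
    T3.Mem S W (fun τ => f τ - g τ) (T3.sub x y) := by
  obtain ⟨c0, c1, hc0, hc1, hcf⟩ := hf
  obtain ⟨d0, d1, hd0, hd1, hdg⟩ := hg
  refine ⟨c0 - d0, c1 - d1, MI.mem_sub hc0 hd0, MI.mem_sub hc1 hd1, fun τ hτ => ?_⟩
  obtain ⟨c2, hc2, ef⟩ := hcf τ hτ
  obtain ⟨d2, hd2, eg⟩ := hdg τ hτ
  exact ⟨c2 - d2, MI.mem_sub hc2 hd2, by simp only [ef, eg]; ring⟩

/-- Product with an exact rational. [folklore] -/
theorem T3.mem_smul {S : ℕ} {W : ℝ} {f : ℝ → ℝ} {x : T3} (hf : T3.Mem S W f x) (q : ℚ) :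
    T3.Mem S W (fun τ => f τ * q) (T3.smul x q) := by
  obtain ⟨c0, c1, hc0, hc1, hcf⟩ := hf
  refine ⟨c0 * q, c1 * q, mem_mulQ hc0 q, mem_mulQ hc1 q, fun τ hτ => ?_⟩
  obtain ⟨c2, hc2, ef⟩ := hcf τ hτ
  exact ⟨c2 * q, mem_mulQ hc2 q, by simp only [ef]; ring⟩

/-- **Membership of the three numerator triples of `quadI2`**: with `u = α + 2a(τ)`, `v = α + 2b(τ)`, `a = a₀ + a₁τ`, `b = b₀ + b₁τ`, the functions
`c·u·v`, `c·(u + v)`, `c` lie in `(quadI2 S c α a₀ a₁ b₀ b₁).1 / .2.1 / .2.2` (for any `W`). [folklore] -/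
theorem T3.mem_quadI2 (S : ℕ) (W : ℝ) (c α a0 a1 b0 b1 : ℚ) :
    T3.Mem S W (fun τ => (c : ℝ) * (((α : ℝ) + 2 * ((a0 : ℝ) + (a1 : ℝ) * τ)) * ((α : ℝ) + 2 * ((b0 : ℝ) + (b1 : ℝ) * τ))))
        (quadI2 S c α a0 a1 b0 b1).1 ∧
      T3.Mem S W (fun τ => (c : ℝ) * (((α : ℝ) + 2 * ((a0 : ℝ) + (a1 : ℝ) * τ)) + ((α : ℝ) + 2 * ((b0 : ℝ) + (b1 : ℝ) * τ))))
        (quadI2 S c α a0 a1 b0 b1).2.1 ∧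
      T3.Mem S W (fun _ => (c : ℝ)) (quadI2 S c α a0 a1 b0 b1).2.2 := by
  refine ⟨?_, ?_, ?_⟩
  · have h := T3.mem_ofRat3 S W (c * (α + 2 * a0) * (α + 2 * b0)) (c * ((α + 2 * a0) * (2 * b1) + (2 * a1) * (α + 2 * b0))) (c * (2 * a1) * (2 * b1))
    refine (T3.Mem_congr ?_).mp h
    intro τ; push_cast; ring
  · have h := T3.mem_ofRat3 S W (c * ((α + 2 * a0) + (α + 2 * b0))) (c * (2 * a1 + 2 * b1)) 0
    refine (T3.Mem_congr ?_).mp h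
    intro τ; push_cast; ring
  · have h := T3.mem_ofRat3 S W c 0 0
    refine (T3.Mem_congr ?_).mp h
    intro τ; push_cast; ring

end HRTMAB2

end Summit.CriticalPhenomena.Ising3D
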